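import Literature.AnabelianGeometry.SemiGraphs.TemperedFunctorialityHomProofs
import HarnessLib

/-!
# Semi-graphs of anabelioids, §3, Proposition 3.6 (iv) — the pull-back functor for an ARBITRARY
# family of conjugating elements (cell ruling ξ2, RQ12)

Mochizuki, *Semi-graphs of anabelioids*, Publ. RIMS **42** (2006), §3, Proposition 3.6 (iv), manuscript
p. 39 [cite: MochizukiSemiAnbd2006, Prop 3.6(iv) p.39], with Remark 2.4.2 p. 26: a morphism of
semi-graphs of anabelioids carries, besides its vertex and edge homomorphisms, the 2-cells `φ_b` — the
compatibilities with the branch maps "up to conjugation" are DATA in print.  The tree's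
`ProfiniteSemiGraph.Hom` records them only as `comm : ∃ g, …` (the 1-skeleton), and the pull-back
functor `Hom.covPullback` of `TemperedFunctorialityProofs.lean` glues along a CHOSEN conjugating
element `Hom.conjugator` (`Classical.choose`).  Two admissible choices at a branch differ by an element
of the centraliser of the image of the edge group, and the resulting pull-backs are in general NOT
isomorphic (cell finding d4-F3 / RQ12).  This ADDITIVE file redoes the construction for an arbitrary
admissible family of conjugating elements `θ : F.ConjugatorFamily` (= a choice of 2-cells):

* `Hom.ConjugatorFamily F` — families `θ_{b'} ∈ Π_{F v'}` with
  `θ_{b'} · ((F b')_* ∘ F_{e'}) · θ_{b'}⁻¹ = F_{v'} ∘ b'_*`; `Hom.chosenConjugators F` = the chosen one;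
* `Hom.gluingIsoWith`, `Hom.covPullbackObjWith`, `Hom.covPullbackMapWith`, `Hom.covPullbackWith θ`,
  with `Hom.covPullback_eq_covPullbackWith : F.covPullback = F.covPullbackWith F.chosenConjugators`
  (definitional);
* the every-`θ` forms of the part-1 facts: definitional squares with the restrictions, points and
  components, `isTempered_covPullbackWith`, `Hom.btempPullbackWith : B^temp(G) ⥤ B^temp(G')`,
  and the chart form `Hom.chartPullbackWith θ c' c : B^temp(π₁^temp G) ⥤ B^temp(π₁^temp G')`
  (`chartPullback = chartPullbackWith chosenConjugators`, definitional).
Exactness and the Proposition 3.2 step for every `θ` are the sequel (`…WithHom`).  Nothing here takes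
a side on [IUTchIII] Cor. 3.12.
-/

noncomputable section

namespace Literature.AnabelianGeometry.SemiGraphs

namespace ProfiniteSemiGraph

open CategoryTheory

universe u

variable {𝒢' 𝒢 : ProfiniteSemiGraph.{u}}

namespace Hom

variable (F : Hom 𝒢' 𝒢)

/-- **A family of conjugating elements** for `F` (a choice of the 2-cells of Remark 2.4.2): for every
branch `b'` of `G'` abutting to `v'`, an element `θ_{b'} ∈ Π_{F v'}` with
`θ_{b'} · ((F b')_* ∘ F_{e'})(x) · θ_{b'}⁻¹ = (F_{v'} ∘ b'_*)(x)` — exactly the property recorded for the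
chosen element by `Hom.conjugator_spec`. [cite: MochizukiSemiAnbd2006, Rmk 2.4.2 p.26] -/
structure ConjugatorFamily : Type u where
  /-- the conjugating elements `θ_{b'} ∈ Π_{F v'}` -/
  θ : ∀ (b' : 𝒢'.graph.Branch) (v' : 𝒢'.graph.Vertex) (_ : 𝒢'.graph.abuts b' = some v'),
    𝒢.Gv (F.base.vertexMap v')
  /-- `θ_{b'}` conjugates `(F b')_* ∘ F_{e'}` into `F_{v'} ∘ b'_*` -/
  spec : ∀ (b' : 𝒢'.graph.Branch) (v' : 𝒢'.graph.Vertex) (h' : 𝒢'.graph.abuts b' = some v')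
    (x : 𝒢'.Ge (𝒢'.graph.edgeOf b')),
    θ b' v' h' * F.brComp b' v' h' x * (θ b' v' h')⁻¹ = ((F.hV v').comp (𝒢'.brHom b' v' h')) x

/-- The CHOSEN family of conjugating elements (`Hom.conjugator`, `Hom.conjugator_spec`).
[cite: MochizukiSemiAnbd2006, Rmk 2.4.2 p.26] -/
def chosenConjugators : F.ConjugatorFamily := ⟨F.conjugator, F.conjugator_spec⟩

variable (θ : F.ConjugatorFamily)


/-- The gluing of the pull-back along a branch `b'` of `e'` abutting to `v'`, as a natural isomorphism
of functors `B^cov(G) ⥤ B^temp(Π_{e'})`: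
`(S ↦ S_{F e'}) ⋙ B^temp(F_{e'}) ≅ (S ↦ S_{F v'}) ⋙ B^temp((F b')_*) ⋙ B^temp(F_{e'})`
`= (S ↦ S_{F v'}) ⋙ B^temp((F b')_* ∘ F_{e'}) ≅ (S ↦ S_{F v'}) ⋙ B^temp(F_{v'} ∘ b'_*)` — the gluing
of `S` along `F b'`, then the isomorphism of pull-backs along conjugate homomorphisms.
[cite: MochizukiSemiAnbd2006, Prop 3.6(iv) p.39] -/
def gluingIsoWith (b' : 𝒢'.graph.Branch) (v' : 𝒢'.graph.Vertex)
    (h' : 𝒢'.graph.abuts b' = some v') :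
    restrictE 𝒢 (F.base.edgeMap (𝒢'.graph.edgeOf b')) ⋙ BTemp.res (F.hE (𝒢'.graph.edgeOf b')) ≅
      restrictV 𝒢 (F.base.vertexMap v') ⋙
        (BTemp.res (F.hV v') ⋙ BTemp.res (𝒢'.brHom b' v' h')) :=
  Functor.isoWhiskerRight
      (𝒢.glueNatIsoAt (F.base.branchMap b') (F.base.vertexMap v') (F.base.abuts_branchMap b' v' h')
        (F.base.edgeMap (𝒢'.graph.edgeOf b')) (F.base.edgeOf_branchMap b'))
      (BTemp.res (F.hE (𝒢'.graph.edgeOf b'))) ≪≫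
    Functor.associator _ _ _ ≪≫
    Functor.isoWhiskerLeft (restrictV 𝒢 (F.base.vertexMap v'))
      (BTemp.resComp _ _ ≪≫
        BTemp.resIsoOfConj (F.brComp b' v' h') ((F.hV v').comp (𝒢'.brHom b' v' h'))
          (θ.θ b' v' h') (θ.spec b' v' h') ≪≫
        (BTemp.resComp (F.hV v') (𝒢'.brHom b' v' h')).symm)

/-! ### The pull-back functor `F^* : B^cov(G) ⥤ B^cov(G')` -/

/-- The pull-back `F^* S ∈ B^cov(G')` of `S ∈ B^cov(G)`: vertex objects `B^temp(F_{v'}) S_{F v'}`, edge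
objects `B^temp(F_{e'}) S_{F e'}`, glued along `b'` by `gluingIso`.
[cite: MochizukiSemiAnbd2006, Prop 3.6(iv) p.39] -/
def covPullbackObjWith (S : CovObj 𝒢) : CovObj 𝒢' where
  SV v' := (BTemp.res (F.hV v')).obj (S.SV (F.base.vertexMap v'))
  SE e' := (BTemp.res (F.hE e')).obj (S.SE (F.base.edgeMap e'))
  glue b' v' h' := (F.gluingIsoWith θ b' v' h').app S

/-- The pull-back of a morphism of `B^cov(G)` (componentwise restriction of scalars); compatibility
with the gluings is the naturality of `gluingIso`. [cite: MochizukiSemiAnbd2006, Prop 3.6(iv) p.39] -/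
def covPullbackMapWith {S T : CovObj 𝒢} (f : S ⟶ T) :
    F.covPullbackObjWith θ S ⟶ F.covPullbackObjWith θ T where
  fV v' := (BTemp.res (F.hV v')).map (f.fV (F.base.vertexMap v'))
  fE e' := (BTemp.res (F.hE e')).map (f.fE (F.base.edgeMap e'))
  comm b' v' h' := (F.gluingIsoWith θ b' v' h').hom.naturality f

/-- **[SemiAnbd] Proposition 3.6 (iv), the construction**: the pull-back functor
`F^* : B^cov(G) ⥤ B^cov(G')` of a morphism `F : G' → G` of semi-graphs of anabelioids ("pulling back
… coverings of `G` to … coverings of `G'`"). [cite: MochizukiSemiAnbd2006, Prop 3.6(iv) p.39] -/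
def covPullbackWith : CovObj 𝒢 ⥤ CovObj 𝒢' where
  obj S := F.covPullbackObjWith θ S
  map f := F.covPullbackMapWith θ f
  map_id S := by
    refine CovHom.ext ?_ ?_ <;> funext _ <;> simp [covPullbackMapWith, covPullbackObjWith]
  map_comp f g := by
    refine CovHom.ext ?_ ?_ <;> funext _
    · exact (BTemp.res _).map_comp _ _
    · exact (BTemp.res _).map_comp _ _

/-- Vertex objects of the pull-back: `(F^* S)_{v'} = B^temp(F_{v'}) S_{F v'}`.
[cite: MochizukiSemiAnbd2006, Prop 3.6(iv) p.39] -/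
@[simp] theorem covPullbackWith_obj_SV (S : CovObj 𝒢) (v' : 𝒢'.graph.Vertex) :
    ((F.covPullbackWith θ).obj S).SV v' = (BTemp.res (F.hV v')).obj (S.SV (F.base.vertexMap v')) := rfl

/-- Edge objects of the pull-back: `(F^* S)_{e'} = B^temp(F_{e'}) S_{F e'}`.
[cite: MochizukiSemiAnbd2006, Prop 3.6(iv) p.39] -/
@[simp] theorem covPullbackWith_obj_SE (S : CovObj 𝒢) (e' : 𝒢'.graph.Edge) :
    ((F.covPullbackWith θ).obj S).SE e' = (BTemp.res (F.hE e')).obj (S.SE (F.base.edgeMap e')) := rfl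

/-- Vertex components of pulled-back morphisms. [cite: MochizukiSemiAnbd2006, Prop 3.6(iv) p.39] -/
@[simp] theorem covPullbackWith_map_fV {S T : CovObj 𝒢} (f : S ⟶ T) (v' : 𝒢'.graph.Vertex) :
    ((F.covPullbackWith θ).map f).fV v' = (BTemp.res (F.hV v')).map (f.fV (F.base.vertexMap v')) := rfl

/-- Edge components of pulled-back morphisms. [cite: MochizukiSemiAnbd2006, Prop 3.6(iv) p.39] -/
@[simp] theorem covPullbackWith_map_fE {S T : CovObj 𝒢} (f : S ⟶ T) (e' : 𝒢'.graph.Edge) :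
    ((F.covPullbackWith θ).map f).fE e' = (BTemp.res (F.hE e')).map (f.fE (F.base.edgeMap e')) := rfl

/-- **Compatibility with restriction to a vertex**: `F^* ⋙ (S ↦ S_{v'}) = (S ↦ S_{F v'}) ⋙ B^temp(F_{v'})`
— the square behind the compatibility of the induced `π₁^temp(G') → π₁^temp(G)` with the verticial
homomorphisms (Prop. 3.6 (iv) / Thm. 3.7 (i)). [cite: MochizukiSemiAnbd2006, Prop 3.6(iv) p.39] -/
theorem covPullbackWith_comp_restrictV (v' : 𝒢'.graph.Vertex) :
    F.covPullbackWith θ ⋙ restrictV 𝒢' v' = restrictV 𝒢 (F.base.vertexMap v') ⋙ BTemp.res (F.hV v') :=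
  rfl

/-- Compatibility with restriction to an edge: `F^* ⋙ (S ↦ S_{e'}) = (S ↦ S_{F e'}) ⋙ B^temp(F_{e'})`.
[cite: MochizukiSemiAnbd2006, Prop 3.6(iv) p.39] -/
theorem covPullbackWith_comp_restrictE (e' : 𝒢'.graph.Edge) :
    F.covPullbackWith θ ⋙ restrictE 𝒢' e' = restrictE 𝒢 (F.base.edgeMap e') ⋙ BTemp.res (F.hE e') :=
  rfl


end Hom

namespace Hom

variable (F : Hom 𝒢' 𝒢) (θ : F.ConjugatorFamily)

/-- The map on points `F^* S → S` over `F`: a point of the fibre of `F^* S` over `v'` (resp. `e'`) IS a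
point of the fibre of `S` over `F v'` (resp. `F e'`). [cite: MochizukiSemiAnbd2006, Prop 3.6(iv) p.39] -/
def pointMapWith (S : CovObj 𝒢) : ((F.covPullbackWith θ).obj S).Point → S.Point
  | Sum.inl ⟨v', x⟩ => Sum.inl ⟨F.base.vertexMap v', x⟩
  | Sum.inr ⟨e', x⟩ => Sum.inr ⟨F.base.edgeMap e', x⟩

/-- Underlying function of the gluing of `F^* S` along `b'`: the re-indexed gluing of `S` along `F b'`
followed by the action of the chosen conjugating element. [cite: MochizukiSemiAnbd2006, Prop 3.6(iv) p.39] -/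
theorem covPullbackWith_glue_apply (S : CovObj 𝒢) (b' : 𝒢'.graph.Branch) (v' : 𝒢'.graph.Vertex)
    (h' : 𝒢'.graph.abuts b' = some v')
    (x : (((F.covPullbackWith θ).obj S).SE (𝒢'.graph.edgeOf b')).obj.V) :
    (((F.covPullbackWith θ).obj S).glue b' v' h').hom.hom.hom x =
      (S.SV (F.base.vertexMap v')).obj.ρ (θ.θ b' v' h')
        ((S.glue (F.base.branchMap b') (F.base.vertexMap v') (F.base.abuts_branchMap b' v' h')).hom.hom.hom
          (F.base.edgeOf_branchMap b' ▸ x)) := by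
  change (S.SV (F.base.vertexMap v')).obj.ρ (θ.θ b' v' h')
      (((𝒢.glueNatIsoAt (F.base.branchMap b') (F.base.vertexMap v') (F.base.abuts_branchMap b' v' h')
        _ (F.base.edgeOf_branchMap b')).hom.app S).hom.hom x) = _
  rw [glueNatIsoAt_hom_app_apply]

/-- Points of `F^* S` in one connected component map to points of `S` in one connected component.
[cite: MochizukiSemiAnbd2006, Prop 3.6(iv) p.39] -/
theorem sameComponent_pointMapWith (S : CovObj 𝒢) {p q : ((F.covPullbackWith θ).obj S).Point}
    (hpq : ((F.covPullbackWith θ).obj S).SameComponent p q) :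
    S.SameComponent (F.pointMapWith θ S p) (F.pointMapWith θ S q) := by
  induction hpq with
  | rel a b hab =>
    cases hab with
    | vertex v' g x =>
      exact Relation.EqvGen.rel _ _ (CovObj.Adj.vertex (F.base.vertexMap v') (F.hV v' g) x)
    | edge e' g x =>
      exact Relation.EqvGen.rel _ _ (CovObj.Adj.edge (F.base.edgeMap e') (F.hE e' g) x)
    | glue b' v' h' x =>
      change S.SameComponent (Sum.inr ⟨F.base.edgeMap (𝒢'.graph.edgeOf b'), x⟩)
        (Sum.inl ⟨F.base.vertexMap v', (((F.covPullbackWith θ).obj S).glue b' v' h').hom.hom.hom x⟩)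
      rw [covPullbackWith_glue_apply, S.point_inr_cast (F.base.edgeOf_branchMap b') x]
      exact Relation.EqvGen.trans _ _ _
        (Relation.EqvGen.rel _ _ (CovObj.Adj.glue (F.base.branchMap b') (F.base.vertexMap v')
          (F.base.abuts_branchMap b' v' h') _))
        (Relation.EqvGen.rel _ _ (CovObj.Adj.vertex _ (θ.θ b' v' h') _))
  | refl a => exact Relation.EqvGen.refl _
  | symm a b _ ih => exact Relation.EqvGen.symm _ _ ih
  | trans a b c _ _ ih₁ ih₂ => exact Relation.EqvGen.trans _ _ _ ih₁ ih₂

/-- `F^*` of a finite object is finite. [cite: MochizukiSemiAnbd2006, Prop 3.6(iv) p.39] -/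
theorem isFinite_covPullbackWith {T : CovObj 𝒢} (hT : T.IsFinite) : ((F.covPullbackWith θ).obj T).IsFinite :=
  ⟨fun v' => hT.finite_V (F.base.vertexMap v'), fun e' => hT.finite_E (F.base.edgeMap e')⟩

/-- `F^*` of an object with nonempty fibres has nonempty fibres. [cite: MochizukiSemiAnbd2006, Prop 3.6(iv) p.39] -/
theorem hasNonemptyFibres_covPullbackWith {T : CovObj 𝒢} (hT : T.HasNonemptyFibres) :
    ((F.covPullbackWith θ).obj T).HasNonemptyFibres :=
  ⟨fun v' => hT.nonempty_V (F.base.vertexMap v'), fun e' => hT.nonempty_E (F.base.edgeMap e')⟩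

/-- Splitting is preserved by `F^*`: if `T` splits `S` at the image point, `F^* T` splits `F^* S`.
[cite: MochizukiSemiAnbd2006, Prop 3.6(iv) p.39] -/
theorem splitsAt_covPullbackWith {T S : CovObj 𝒢} {q : ((F.covPullbackWith θ).obj S).Point}
    (h : T.SplitsAt S (F.pointMapWith θ S q)) : ((F.covPullbackWith θ).obj T).SplitsAt ((F.covPullbackWith θ).obj S) q := by
  rcases q with ⟨v', s⟩ | ⟨e', s⟩
  · exact fun x g' hx => h x (F.hV v' g') hx
  · exact fun x g' hx => h x (F.hE e' g') hx

/-- **`F^*` preserves tempered coverings** (Def. 3.5 (ii)): the finite étale covering splitting a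
component of `S` pulls back to one splitting the corresponding component of `F^* S`.
[cite: MochizukiSemiAnbd2006, Prop 3.6(iv) p.39] -/
theorem isTempered_covPullbackWith {S : CovObj 𝒢} (hS : S.IsTempered) : ((F.covPullbackWith θ).obj S).IsTempered := by
  intro p
  obtain ⟨T, hTfin, hTne, hsplit⟩ := hS (F.pointMapWith θ S p)
  exact ⟨(F.covPullbackWith θ).obj T, F.isFinite_covPullbackWith θ hTfin, F.hasNonemptyFibres_covPullbackWith θ hTne,
    fun q hpq => F.splitsAt_covPullbackWith θ (hsplit _ (F.sameComponent_pointMapWith θ S hpq))⟩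

/-- **[SemiAnbd] Proposition 3.6 (iv), the functor `B^temp(G) → B^temp(G')`** ("by pulling back
tempered coverings of `G` to tempered coverings of `G'`"): `F^*` restricted to the tempered objects.
[cite: MochizukiSemiAnbd2006, Prop 3.6(iv) p.39] -/
def btempPullbackWith : BTempCat 𝒢 ⥤ BTempCat 𝒢' :=
  ObjectProperty.lift _ (ObjectProperty.ι _ ⋙ F.covPullbackWith θ) fun S => F.isTempered_covPullbackWith θ S.property

/-- `F^*` on `B^temp` lies over `F^*` on `B^cov` (definitional). [cite: MochizukiSemiAnbd2006, Prop 3.6(iv) p.39] -/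
theorem btempPullbackWith_comp_ι :
    F.btempPullbackWith θ ⋙ ObjectProperty.ι _ = ObjectProperty.ι _ ⋙ F.covPullbackWith θ := rfl


/-- The pull-back functor of part 1 IS the one glued with the chosen family (definitional).
[cite: MochizukiSemiAnbd2006, Prop 3.6(iv) p.39] -/
theorem covPullback_eq_covPullbackWith : F.covPullback = F.covPullbackWith F.chosenConjugators := rfl

/-- `B^temp` version (definitional). [cite: MochizukiSemiAnbd2006, Prop 3.6(iv) p.39] -/
theorem btempPullback_eq_btempPullbackWith :
    F.btempPullback = F.btempPullbackWith F.chosenConjugators := rfl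

/-- The pull-back functor through charts for the family `θ`: `c⁻¹ ⋙ F^*_θ ⋙ c'`.
[cite: MochizukiSemiAnbd2006, Prop 3.6(iv) p.39] -/
def chartPullbackWith (c' : TemperedPiChart 𝒢') (c : TemperedPiChart 𝒢) : BTemp c.G ⥤ BTemp c'.G :=
  c.equiv.inverse ⋙ F.btempPullbackWith θ ⋙ c'.equiv.functor

/-- `chartPullback = chartPullbackWith chosenConjugators` (definitional).
[cite: MochizukiSemiAnbd2006, Prop 3.6(iv) p.39] -/
theorem chartPullback_eq_chartPullbackWith (c' : TemperedPiChart 𝒢') (c : TemperedPiChart 𝒢) :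
    F.chartPullback c' c = F.chartPullbackWith F.chosenConjugators c' c := rfl

end Hom

end ProfiniteSemiGraph

end Literature.AnabelianGeometry.SemiGraphs

end
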